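import Summits.Ventures.DiscreteObjects.PP12.OrderThirteenRelabel
import Summits.Ventures.DiscreteObjects.PP12.OrderThirteenOrbitMatrix
import Summits.Ventures.DiscreteObjects.PP12.DoublyLexical

/-!
# PP(12), order-13 cell: WLOG the orbit matrix of valid lift data is doubly lexical (kernel; symmetry reduction for a certificate)
Framing: lottery ticket; floor = certified bounds/negative ranges.

Cell pub-namedobj (venture DiscreteObjects), target (M), designs gen 18. Combines `OrderThirteenRelabel` (relabelling invariance of `LiftData.Valid`),
`OrderThirteenOrbitMatrix` (`LiftData.om`) and `DoublyLexical` (existence of doubly lexical orderings): the orbit matrix of relabelled data is the relabelled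
orbit matrix (`om_relabel`), so every valid lift data has a valid relabelling whose orbit matrix has lexicographically non-increasing rows AND columns
(`exists_relabel_om_doublyLex`); hence **`noLiftData13_of_doublyLex`**: to prove `NoLiftData13` it suffices to refute the valid lift data whose orbit
matrix is doubly lexical — exactly the 836 matrices (38 classes) of designs g3's `p13om.c`, once they are enumerated in the kernel from
`LiftData.om_equations`. Pure logic; nothing asserts any census statement. No `sorry`, no new axioms.
-/

namespace Summit.Ventures.DiscreteObjects.PP12

namespace LiftData

variable {N p : ℕ}

/-- the orbit matrix of relabelled data is the relabelled orbit matrix -/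
theorem om_relabel (D : LiftData N p) (ρ τ : Equiv.Perm (Fin N)) (s t : Fin N) : (D.relabel ρ τ).om s t = D.om (ρ s) (τ t) := rfl

/-- the orbit matrix, as a matrix, has lexicographically non-increasing rows and columns -/
structure OmDoublyLex (D : LiftData N p) : Prop where
  /-- later rows of the orbit matrix are lexicographically not larger -/
  rows : ∀ s s' : Fin N, s < s' → toLex (fun t => D.om s' t) ≤ toLex (fun t => D.om s t)
  /-- later columns of the orbit matrix are lexicographically not larger -/
  cols : ∀ t t' : Fin N, t < t' → toLex (fun s => D.om s t') ≤ toLex (fun s => D.om s t)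

/-- **every lift data has a relabelling with a doubly lexical orbit matrix** -/
theorem exists_relabel_om_doublyLex (D : LiftData N p) : ∃ ρ τ : Equiv.Perm (Fin N), (D.relabel ρ τ).OmDoublyLex := by
  obtain ⟨ρ, τ, h⟩ := DoublyLex.exists_doublyLex (fun s t => D.om s t)
  exact ⟨ρ, τ, ⟨fun s s' hss => h.rows s s' hss, fun t t' htt => h.cols t t' htt⟩⟩

end LiftData

/-- **Symmetry reduction, concrete form:** to refute all valid lift data `LiftData 11 13` it suffices to refute those whose orbit matrix is doubly
lexical (rows and columns lexicographically non-increasing). -/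
theorem noLiftData13_of_doublyLex (h : ∀ D : LiftData 11 13, D.OmDoublyLex → ¬ D.Valid) : NoLiftData13 :=
  noLiftData13_of_normalized LiftData.OmDoublyLex (fun D _ => D.exists_relabel_om_doublyLex) h

end Summit.Ventures.DiscreteObjects.PP12
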